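import Literature.NumberTheory.PAdicHodge.BdRPlusTopology
import Literature.AlgebraicGeometry.Resolution.MvPowerSeriesChainRule
import Mathlib.RingTheory.PowerSeries.Log
import HarnessLib

/-!
# The logarithm on `1 + Fil¹ B_dR⁺(F)`: `log(xy) = log x + log y`, `Γ_F`-equivariance, `log[ε] = t`

Topic `Literature/NumberTheory/PAdicHodge`; namespace `Literature.NumberTheory.PAdicHodge`. Fontaine's element
`t = log[ε] ∈ B_dR⁺` (tree `BdRPlusLog.tBdR`) is ONE value of the `ξ`-adically convergent logarithm

  `log : 1 + Fil¹B_dR⁺(F) → Fil¹B_dR⁺(F)`,   `log(1 + x) = Σ_{n ≥ 1} (-1)^(n+1) xⁿ/n`   (`x ∈ Fil¹ = ker θ = (ξ_dR)`),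

which this file constructs once and for all (Mathlib's series `PowerSeries.log` evaluated through the tree's `ξ`-adic
evaluation `LubinTate.evalPt₁` on the closed nil ideal `BdRPlusTop.filOne`), together with the three properties every
period computation uses (Fontaine, Astérisque 223, Exp. II §1.5.4–1.5.5; Fontaine–Ouyang §5.1.2):

* §1 (pure algebra, any commutative `ℚ`-algebra `A`) **the functional equation of the logarithm series**:
  `(1 + X) · d/dX log(1+X) = 1` (`one_add_X_mul_derivative_log`) and
  `log((1+X₀)(1+X₁)) = log(1+X₀) + log(1+X₁)` in `A⟦X₀, X₁⟧` (`log_subst_mulOneAdd`), by the derivation calculus of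
  `MvPowerSeriesChainRule` (both partial derivatives of the defect vanish, and so does its constant term);
* §2 **`BdRPlusTop.logOneAdd x := log(1 + x) ∈ Fil¹`** for `x ∈ Fil¹B_dR⁺(F)`: additivity
  `log((1+x)(1+y)) = log(1+x) + log(1+y)` (`logOneAdd_mulOneAdd`, transport of §1 by `evalPt₁_subst`), powers,
  inverses, and `Γ_F`-equivariance `σ(log(1+x)) = log(1+σx)` (`gal_logOneAdd`, from `BdRPlusTop.gal_evalPt₁`);
* §3 **truncations**: `log(1+x) ≡ L_N(x) (mod Fil^{N+1})` for the tree's truncated logarithms `TruncatedLog.logTrunc N`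
  (`logOneAdd_sub_aeval_logTrunc_mem`), whence **`log(1 + ([ε] − 1)) = t`** (`logOneAdd_uBdR`: the tree's `tBdR` IS a value
  of `logOneAdd`) and the transformation law is recovered as an instance of equivariance.

Use: the `B_dR⁺`-integration of Kummer cocycles of `𝔾_m` (`ℓ_u = log([ũ]/u)`, Bloch–Kato Ex. 3.10.1 for `ℚ_p(1)`; the
input of Kato LNM 1553 II Lemma 1.4.4) and, more generally, every "`∫ dT/(1+T)`" on `1 + ker θ`. Infrastructure only:
nothing about elliptic curves or BSD is proved here.

## References
* J.-M. Fontaine, *Le corps des périodes p-adiques*, Astérisque 223 (1994), Exp. II §1.5.4–1.5.5. [FontaineAsterisque223III]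
* J.-M. Fontaine, Y. Ouyang, *Theory of p-adic Galois representations*, §5.1.2. [FontaineOuyang2022]
* N. Bourbaki, *Algèbre*, Ch. IV §4 no. 5 (dérivations des séries formelles).
-/

noncomputable section

open MvPowerSeries

namespace Literature.NumberTheory.PAdicHodge

open Literature.AlgebraicGeometry.Resolution (MvPowerSeries.pderiv MvPowerSeries.coeff_pderiv
  MvPowerSeries.pderiv_X MvPowerSeries.pderiv_powerSeries_subst MvPowerSeries.pderiv_powerSeries_subst_X
  MvPowerSeries.coeff_eq_zero_of_pderiv_eq_zero)

/-! ## §1 The functional equation of `log(1 + X)` as an identity of formal power series -/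

namespace LogSeries

variable (A : Type*) [CommRing A] [Algebra ℚ A]

/-- **`(1 + X) · d/dX log(1+X) = 1`**: the derivative of the logarithm series is the geometric series `1/(1+X)`
(Mathlib `PowerSeries.deriv_log`), written as a unit equation. [cite: FontaineAsterisque223III, Exp. II §1.5.4] -/
theorem one_add_X_mul_derivative_log :
    (1 + PowerSeries.X : PowerSeries A) * PowerSeries.derivative A (PowerSeries.log A) = 1 := by
  rw [PowerSeries.deriv_log]
  ext n
  rw [add_mul, one_mul, map_add, PowerSeries.coeff_one]
  rcases n with _ | n
  · rw [PowerSeries.coeff_zero_X_mul, add_zero, PowerSeries.coeff_mk, pow_zero, map_one, if_pos rfl]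
  · rw [PowerSeries.coeff_succ_X_mul, PowerSeries.coeff_mk, PowerSeries.coeff_mk, if_neg (Nat.succ_ne_zero n),
      ← map_add, pow_succ, mul_neg_one, neg_add_cancel, map_zero]

variable {A} in
/-- Substituting a constant-term-free series `B` into `(1 + X) · log'(1+X) = 1`: `(1 + B) · log'(1 + B) = 1`.
[cite: FontaineAsterisque223III, Exp. II §1.5.4] -/
theorem one_add_mul_derivative_log_subst {τ : Type*} (B : MvPowerSeries τ A) (hB : constantCoeff B = 0) :
    (1 + B) * (PowerSeries.derivative A (PowerSeries.log A)).subst B = 1 := by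
  have hs : PowerSeries.HasSubst B := PowerSeries.HasSubst.of_constantCoeff_zero hB
  have h := congrArg (PowerSeries.subst B) (one_add_X_mul_derivative_log A)
  rwa [PowerSeries.subst_mul hs, ← PowerSeries.coe_substAlgHom hs, map_add, map_one,
    PowerSeries.coe_substAlgHom hs, PowerSeries.subst_X hs] at h

/-- **The functional equation `log((1+X₀)(1+X₁)) = log(1+X₀) + log(1+X₁)`** in `A⟦X₀, X₁⟧` over any commutative
`ℚ`-algebra: `log(1+T)` composed with the multiplicative formal group law `X₀ + X₁ + X₀X₁` is the sum of the two
logarithms. Proof: the defect `D` has `∂₀D = log'(1+G)(1+X₁) − log'(1+X₀) = 0` because `(1+G) log'(1+G) = 1 =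
(1+X₀) log'(1+X₀)` and `1 + G = (1+X₀)(1+X₁)`; symmetrically `∂₁D = 0`; and `D(0,0) = 0`.
[cite: FontaineAsterisque223III, Exp. II §1.5.4] -/
theorem log_subst_mulOneAdd :
    (PowerSeries.log A).subst (X 0 + X 1 + X 0 * X 1 : MvPowerSeries (Fin 2) A) =
      (PowerSeries.log A).subst (X 0 : MvPowerSeries (Fin 2) A) +
        (PowerSeries.log A).subst (X 1 : MvPowerSeries (Fin 2) A) := by
  classical
  haveI : IsAddTorsionFree A := IsAddTorsionFree.of_module_rat (M := A)
  set G : MvPowerSeries (Fin 2) A := X 0 + X 1 + X 0 * X 1 with hG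
  have hG0 : constantCoeff G = 0 := by
    simp only [hG, map_add, map_mul, constantCoeff_X, add_zero, mul_zero]
  have hX0 : constantCoeff (X 0 : MvPowerSeries (Fin 2) A) = 0 := constantCoeff_X 0
  have hX1 : constantCoeff (X 1 : MvPowerSeries (Fin 2) A) = 0 := constantCoeff_X 1
  -- `1 + G = (1 + X₀)(1 + X₁)` and the three unit equations
  have hfac : (1 + G : MvPowerSeries (Fin 2) A) = (1 + X 0) * (1 + X 1) := by rw [hG]; ring
  have hEG := one_add_mul_derivative_log_subst G hG0
  rw [hfac] at hEG
  have hE0 := one_add_mul_derivative_log_subst (X 0 : MvPowerSeries (Fin 2) A) hX0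
  have hE1 := one_add_mul_derivative_log_subst (X 1 : MvPowerSeries (Fin 2) A) hX1
  -- the partial derivatives of `G`
  have hdG0 : MvPowerSeries.pderiv 0 G = 1 + X 1 := by
    rw [hG, map_add, map_add, (MvPowerSeries.pderiv 0).leibniz, MvPowerSeries.pderiv_X, MvPowerSeries.pderiv_X,
      if_pos rfl, if_neg (by decide), smul_eq_mul, smul_eq_mul]
    ring
  have hdG1 : MvPowerSeries.pderiv 1 G = 1 + X 0 := by
    rw [hG, map_add, map_add, (MvPowerSeries.pderiv 1).leibniz, MvPowerSeries.pderiv_X, MvPowerSeries.pderiv_X,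
      if_neg (by decide), if_pos rfl, smul_eq_mul, smul_eq_mul]
    ring
  -- the defect and its partial derivatives
  set D := (PowerSeries.log A).subst G - (PowerSeries.log A).subst (X 0 : MvPowerSeries (Fin 2) A) -
    (PowerSeries.log A).subst (X 1 : MvPowerSeries (Fin 2) A) with hD
  have hu : IsUnit ((1 + X 0) * (1 + X 1) : MvPowerSeries (Fin 2) A) := by
    rw [MvPowerSeries.isUnit_iff_constantCoeff, map_mul, map_add, map_add, map_one, hX0, hX1, add_zero, mul_one]
    exact isUnit_one
  have hD0 : MvPowerSeries.pderiv 0 D = 0 := by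
    have h : MvPowerSeries.pderiv 0 D =
        (PowerSeries.derivative A (PowerSeries.log A)).subst G * (1 + X 1) -
          (PowerSeries.derivative A (PowerSeries.log A)).subst (X 0 : MvPowerSeries (Fin 2) A) := by
      rw [hD, map_sub, map_sub, MvPowerSeries.pderiv_powerSeries_subst hG0, hdG0,
        MvPowerSeries.pderiv_powerSeries_subst_X, MvPowerSeries.pderiv_powerSeries_subst_X, if_pos rfl,
        if_neg (by decide), sub_zero]
    have h' : ((1 + X 0) * (1 + X 1)) * MvPowerSeries.pderiv 0 D = 0 := by
      rw [h]
      linear_combination (1 + X 1 : MvPowerSeries (Fin 2) A) * hEG - (1 + X 1 : MvPowerSeries (Fin 2) A) * hE0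
    exact (hu.mul_right_eq_zero).mp h'
  have hD1 : MvPowerSeries.pderiv 1 D = 0 := by
    have h : MvPowerSeries.pderiv 1 D =
        (PowerSeries.derivative A (PowerSeries.log A)).subst G * (1 + X 0) -
          (PowerSeries.derivative A (PowerSeries.log A)).subst (X 1 : MvPowerSeries (Fin 2) A) := by
      rw [hD, map_sub, map_sub, MvPowerSeries.pderiv_powerSeries_subst hG0, hdG1,
        MvPowerSeries.pderiv_powerSeries_subst_X, MvPowerSeries.pderiv_powerSeries_subst_X, if_neg (by decide),
        if_pos rfl, sub_zero]
    have h' : ((1 + X 0) * (1 + X 1)) * MvPowerSeries.pderiv 1 D = 0 := by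
      rw [h]
      linear_combination (1 + X 0 : MvPowerSeries (Fin 2) A) * hEG - (1 + X 0 : MvPowerSeries (Fin 2) A) * hE1
    exact (hu.mul_right_eq_zero).mp h'
  -- the constant term of the defect
  have hDc : constantCoeff D = 0 := by
    rw [hD, map_sub, map_sub, PowerSeries.constantCoeff_subst_eq_zero hG0 _ PowerSeries.constantCoeff_log,
      PowerSeries.constantCoeff_subst_eq_zero hX0 _ PowerSeries.constantCoeff_log,
      PowerSeries.constantCoeff_subst_eq_zero hX1 _ PowerSeries.constantCoeff_log, sub_zero, sub_zero]
  -- conclusion: `D = 0`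
  have hDz : D = 0 := by
    ext e
    rw [map_zero]
    by_cases h0 : e 0 = 0
    · by_cases h1 : e 1 = 0
      · have he : e = 0 := by
          ext j; fin_cases j
          · simpa using h0
          · simpa using h1
        rw [he, MvPowerSeries.coeff_zero_eq_constantCoeff_apply, hDc]
      · exact MvPowerSeries.coeff_eq_zero_of_pderiv_eq_zero hD1 h1
    · exact MvPowerSeries.coeff_eq_zero_of_pderiv_eq_zero hD0 h0
  rw [hD, sub_sub, sub_eq_zero] at hDz
  exact hDz

end LogSeries

/-! ## §2 `log(1 + x)` for `x ∈ Fil¹ B_dR⁺(F)` -/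

namespace BdRPlusTop

open Literature.NumberTheory.GaloisRepresentations
open Literature.NumberTheory.GaloisRepresentations.IsNonarchimedeanLocalField
open Literature.NumberTheory.GaloisRepresentations.LubinTate
open TruncatedLog Field

variable {F : Type} [Field F] [ValuativeRel F] [TopologicalSpace F] [IsNonarchimedeanLocalField F] [CharZero F]
  {p : ℕ} [Fact p.Prime] [Fact (¬ IsUnit (p : integerC F))]
  [IsAdicComplete (Ideal.span {(p : integerC F)}) (integerC F)]

/-- The logarithm series `log(1+X) ∈ ℚ⟦X⟧` over the discrete coefficient ring `RatCoeff` (Mathlib `PowerSeries.log`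
transported along `ℚ = RatCoeff`). [cite: FontaineAsterisque223III, Exp. II §1.5.4] -/
def logQ : PowerSeries RatCoeff := PowerSeries.map RatCoeff.of.toRingHom (PowerSeries.log ℚ)

omit [CharZero F] [Fact p.Prime] [Fact (¬ IsUnit (p : integerC F))]
  [IsAdicComplete (Ideal.span {(p : integerC F)}) (integerC F)] in
/-- `log(1 + 0) = 0`: no constant term. [cite: FontaineAsterisque223III, Exp. II §1.5.4] -/
theorem constantCoeff_logQ : PowerSeries.constantCoeff logQ = 0 := by
  rw [logQ, ← PowerSeries.coeff_zero_eq_constantCoeff_apply, PowerSeries.coeff_map,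
    PowerSeries.coeff_zero_eq_constantCoeff_apply, PowerSeries.constantCoeff_log, map_zero]

omit [CharZero F] [Fact p.Prime] [Fact (¬ IsUnit (p : integerC F))]
  [IsAdicComplete (Ideal.span {(p : integerC F)}) (integerC F)] in
/-- The coefficients of `logQ`: `0, 1, -1/2, 1/3, …`. [cite: FontaineAsterisque223III, Exp. II §1.5.4] -/
theorem coeff_logQ (n : ℕ) :
    PowerSeries.coeff n logQ = if n = 0 then 0 else RatCoeff.of ((-1 : ℚ) ^ (n + 1) / n) := by
  rw [logQ, PowerSeries.coeff_map, PowerSeries.coeff_log]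
  split_ifs with h
  · rw [map_zero]
  · rfl

omit [CharZero F] [Fact p.Prime] [Fact (¬ IsUnit (p : integerC F))]
  [IsAdicComplete (Ideal.span {(p : integerC F)}) (integerC F)] in
/-- **The functional equation over `RatCoeff`**: `logQ(X₀ + X₁ + X₀X₁) = logQ(X₀) + logQ(X₁)` (transport of
`LogSeries.log_subst_mulOneAdd` along `ℚ = RatCoeff`). [cite: FontaineAsterisque223III, Exp. II §1.5.4] -/
theorem logQ_subst_mulOneAdd :
    logQ.subst (X 0 + X 1 + X 0 * X 1 : MvPowerSeries (Fin 2) RatCoeff) =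
      logQ.subst (X 0 : MvPowerSeries (Fin 2) RatCoeff) + logQ.subst (X 1 : MvPowerSeries (Fin 2) RatCoeff) := by
  set φ : ℚ →+* RatCoeff := RatCoeff.of.toRingHom with hφ
  have hG0 : constantCoeff (X 0 + X 1 + X 0 * X 1 : MvPowerSeries (Fin 2) ℚ) = 0 := by
    simp only [map_add, map_mul, constantCoeff_X, add_zero, mul_zero]
  have hsG : PowerSeries.HasSubst (X 0 + X 1 + X 0 * X 1 : MvPowerSeries (Fin 2) ℚ) :=
    PowerSeries.HasSubst.of_constantCoeff_zero hG0
  have hmapG : MvPowerSeries.map φ (X 0 + X 1 + X 0 * X 1 : MvPowerSeries (Fin 2) ℚ) =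
      (X 0 + X 1 + X 0 * X 1 : MvPowerSeries (Fin 2) RatCoeff) := by
    simp only [map_add, map_mul, MvPowerSeries.map_X]
  have h := congrArg (MvPowerSeries.map φ) (LogSeries.log_subst_mulOneAdd ℚ)
  rw [map_add, PowerSeries.map_subst hsG, PowerSeries.map_subst (PowerSeries.HasSubst.X 0),
    PowerSeries.map_subst (PowerSeries.HasSubst.X 1), hmapG, MvPowerSeries.map_X, MvPowerSeries.map_X] at h
  exact h

/-- **`log(1 + x) ∈ Fil¹ B_dR⁺(F)` for `x ∈ Fil¹ = (ξ_dR)`**: the `ξ`-adically convergent series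
`Σ_{n≥1} (-1)^(n+1) xⁿ/n` (tree `LubinTate.evalPt₁` on the closed nil ideal `filOne`).
[cite: FontaineAsterisque223III, Exp. II §1.5.4] [cite: FontaineOuyang2022, §5.1.2] -/
def logOneAdd (x : (filOne F p).toIdeal) : (filOne F p).toIdeal :=
  evalPt₁ (filOne F p) logQ constantCoeff_logQ x

/-- `log(1 + x) ∈ Fil¹`. [cite: FontaineAsterisque223III, Exp. II §1.5.4] -/
theorem logOneAdd_mem_filOne (x : (filOne F p).toIdeal) : (logOneAdd x : BdRPlusTop F p) ∈ (filOne F p).toIdeal :=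
  (logOneAdd x).2

/-- `logOneAdd` depends only on the element (not on the membership proof). [cite: FontaineAsterisque223III, Exp. II §1.5.4] -/
theorem logOneAdd_congr {x y : (filOne F p).toIdeal} (h : (x : BdRPlusTop F p) = y) : logOneAdd x = logOneAdd y := by
  rw [Subtype.ext h]

omit [CharZero F] in
/-- `x + y + xy ∈ Fil¹` for `x, y ∈ Fil¹`: `1 + Fil¹` is closed under multiplication (`Fil¹ = ker θ` is an ideal).
[cite: FontaineAsterisque223III, Exp. II §1.5.4] -/
theorem add_add_mul_mem_filOne (x y : (filOne F p).toIdeal) :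
    (x : BdRPlusTop F p) + (y : BdRPlusTop F p) + (x : BdRPlusTop F p) * (y : BdRPlusTop F p) ∈
      (filOne F p).toIdeal :=
  add_mem (add_mem x.2 y.2) (Ideal.mul_mem_left _ _ y.2)

/-- **Additivity: `log((1+x)(1+y)) = log(1+x) + log(1+y)`** on `Fil¹ B_dR⁺(F)`, i.e.
`logOneAdd (x + y + xy) = logOneAdd x + logOneAdd y` (the functional equation `logQ_subst_mulOneAdd` evaluated
`ξ`-adically, `evalPt₁_subst`). [cite: FontaineAsterisque223III, Exp. II §1.5.4] [cite: FontaineOuyang2022, §5.1.2] -/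
theorem logOneAdd_mulOneAdd (x y : (filOne F p).toIdeal) :
    (logOneAdd ⟨(x : BdRPlusTop F p) + (y : BdRPlusTop F p) + (x : BdRPlusTop F p) * (y : BdRPlusTop F p),
        add_add_mul_mem_filOne x y⟩ : BdRPlusTop F p) =
      logOneAdd x + logOneAdd y := by
  have hG0 : constantCoeff (X 0 + X 1 + X 0 * X 1 : MvPowerSeries (Fin 2) RatCoeff) = 0 := by
    simp only [map_add, map_mul, constantCoeff_X, add_zero, mul_zero]
  have hX0 : ∀ i : Fin 2, (logQ.subst (MvPowerSeries.X i : MvPowerSeries (Fin 2) RatCoeff)).constantCoeff = 0 :=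
    fun i => constantCoeff_subst_zero (σ := Unit) (fun _ => MvPowerSeries.constantCoeff_X i) constantCoeff_logQ
  have hsub0 : (logQ.subst (X 0 + X 1 + X 0 * X 1 : MvPowerSeries (Fin 2) RatCoeff)).constantCoeff = 0 :=
    constantCoeff_subst_zero (σ := Unit) (fun _ => hG0) constantCoeff_logQ
  have hsum0 : (logQ.subst (X 0 : MvPowerSeries (Fin 2) RatCoeff) +
      logQ.subst (X 1 : MvPowerSeries (Fin 2) RatCoeff)).constantCoeff = 0 := by
    rw [map_add, hX0 0, hX0 1, add_zero]
  -- the point `x + y + xy` is the value of the series `X₀ + X₁ + X₀X₁`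
  have hpt : (⟨(x : BdRPlusTop F p) + (y : BdRPlusTop F p) + (x : BdRPlusTop F p) * (y : BdRPlusTop F p),
      add_add_mul_mem_filOne x y⟩ : (filOne F p).toIdeal) =
      evalPt (filOne F p) (X 0 + X 1 + X 0 * X 1 : MvPowerSeries (Fin 2) RatCoeff) hG0 ![x, y] := by
    apply Subtype.ext
    rw [coe_evalPt, map_add, map_add, map_mul, aeval_X', aeval_X']
    rfl
  rw [logOneAdd, hpt, ← evalPt₁_subst (filOne F p) _ hG0 logQ constantCoeff_logQ hsub0,
    evalPt_congr (filOne F p) logQ_subst_mulOneAdd hsub0 hsum0 ![x, y], coe_evalPt, map_add,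
    ← coe_evalPt (filOne F p) _ (hX0 0), ← coe_evalPt (filOne F p) _ (hX0 1),
    evalPt₁_subst (filOne F p) (MvPowerSeries.X 0 : MvPowerSeries (Fin 2) RatCoeff) (MvPowerSeries.constantCoeff_X 0)
      logQ constantCoeff_logQ (hX0 0),
    evalPt₁_subst (filOne F p) (MvPowerSeries.X 1 : MvPowerSeries (Fin 2) RatCoeff) (MvPowerSeries.constantCoeff_X 1)
      logQ constantCoeff_logQ (hX0 1), evalPt_X, evalPt_X]
  rfl

/-- **`log(1) = 0`**: `logOneAdd 0 = 0`. [cite: FontaineAsterisque223III, Exp. II §1.5.4] -/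
theorem logOneAdd_zero : (logOneAdd (0 : (filOne F p).toIdeal) : BdRPlusTop F p) = 0 := by
  have h := logOneAdd_mulOneAdd (0 : (filOne F p).toIdeal) 0
  have h0 : (⟨((0 : (filOne F p).toIdeal) : BdRPlusTop F p) + ((0 : (filOne F p).toIdeal) : BdRPlusTop F p) +
      ((0 : (filOne F p).toIdeal) : BdRPlusTop F p) * ((0 : (filOne F p).toIdeal) : BdRPlusTop F p),
        add_add_mul_mem_filOne 0 0⟩ : (filOne F p).toIdeal) = 0 :=
    Subtype.ext (by simp)
  rw [h0] at h
  linear_combination -h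

/-- **Multiplicative form.** For `b, b'' ∈ 1 + Fil¹`: `log(b b'') = log b + log b''`, where `log b := logOneAdd (b - 1)`.
[cite: FontaineAsterisque223III, Exp. II §1.5.4] [cite: FontaineOuyang2022, §5.1.2] -/
theorem logOneAdd_mul_sub_one {b b'' : BdRPlusTop F p} (hb : b - 1 ∈ (filOne F p).toIdeal)
    (hb'' : b'' - 1 ∈ (filOne F p).toIdeal) (hbb : b * b'' - 1 ∈ (filOne F p).toIdeal) :
    (logOneAdd ⟨b * b'' - 1, hbb⟩ : BdRPlusTop F p) = logOneAdd ⟨b - 1, hb⟩ + logOneAdd ⟨b'' - 1, hb''⟩ := by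
  rw [← logOneAdd_mulOneAdd]
  exact congrArg Subtype.val (logOneAdd_congr (by push_cast; ring))

omit [CharZero F] in
/-- `b b'' ∈ 1 + Fil¹` when `b, b'' ∈ 1 + Fil¹` (`Fil¹ = ker θ` is an ideal). [cite: FontaineAsterisque223III, Exp. II §1.5.4] -/
theorem mul_sub_one_mem_filOne {b b'' : BdRPlusTop F p} (hb : b - 1 ∈ (filOne F p).toIdeal)
    (hb'' : b'' - 1 ∈ (filOne F p).toIdeal) : b * b'' - 1 ∈ (filOne F p).toIdeal := by
  have e : b * b'' - 1 = (b - 1) + (b'' - 1) + (b - 1) * (b'' - 1) := by ring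
  rw [e]
  exact add_mem (add_mem hb hb'') (Ideal.mul_mem_left _ _ hb'')

omit [CharZero F] in
/-- `bⁿ ∈ 1 + Fil¹` when `b ∈ 1 + Fil¹`. [cite: FontaineAsterisque223III, Exp. II §1.5.4] -/
theorem pow_sub_one_mem_filOne {b : BdRPlusTop F p} (hb : b - 1 ∈ (filOne F p).toIdeal) (n : ℕ) :
    b ^ n - 1 ∈ (filOne F p).toIdeal := by
  induction n with
  | zero => rw [pow_zero, sub_self]; exact zero_mem _
  | succ n ih => rw [pow_succ]; exact mul_sub_one_mem_filOne ih hb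

/-- **Powers: `log(bⁿ) = n · log b`** for `b ∈ 1 + Fil¹`. [cite: FontaineAsterisque223III, Exp. II §1.5.4] -/
theorem logOneAdd_pow_sub_one {b : BdRPlusTop F p} (hb : b - 1 ∈ (filOne F p).toIdeal) (n : ℕ) :
    (logOneAdd ⟨b ^ n - 1, pow_sub_one_mem_filOne hb n⟩ : BdRPlusTop F p) = n * logOneAdd ⟨b - 1, hb⟩ := by
  induction n with
  | zero =>
    have h0 : (⟨b ^ 0 - 1, pow_sub_one_mem_filOne hb 0⟩ : (filOne F p).toIdeal) = 0 :=
      Subtype.ext (by show b ^ 0 - 1 = (0 : BdRPlusTop F p); rw [pow_zero, sub_self])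
    rw [h0, logOneAdd_zero, Nat.cast_zero, zero_mul]
  | succ n ih =>
    rw [logOneAdd_congr (show ((⟨b ^ (n + 1) - 1, pow_sub_one_mem_filOne hb (n + 1)⟩ : (filOne F p).toIdeal) :
        BdRPlusTop F p) = (⟨b ^ n * b - 1, mul_sub_one_mem_filOne (pow_sub_one_mem_filOne hb n) hb⟩ :
          (filOne F p).toIdeal) by show b ^ (n + 1) - 1 = b ^ n * b - 1; rw [pow_succ]),
      logOneAdd_mul_sub_one (pow_sub_one_mem_filOne hb n) hb, ih, Nat.cast_succ]
    ring

/-- **Inverses: `log(b⁻¹) = -log b`** for `b ∈ 1 + Fil¹` with inverse `c` (`b c = 1`).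
[cite: FontaineAsterisque223III, Exp. II §1.5.4] -/
theorem logOneAdd_inv_sub_one {b c : BdRPlusTop F p} (hb : b - 1 ∈ (filOne F p).toIdeal)
    (hc : c - 1 ∈ (filOne F p).toIdeal) (hbc : b * c = 1) :
    (logOneAdd ⟨c - 1, hc⟩ : BdRPlusTop F p) = -logOneAdd ⟨b - 1, hb⟩ := by
  have h := logOneAdd_mul_sub_one hb hc (mul_sub_one_mem_filOne hb hc)
  have h1 : (⟨b * c - 1, mul_sub_one_mem_filOne hb hc⟩ : (filOne F p).toIdeal) = 0 :=
    Subtype.ext (by show b * c - 1 = (0 : BdRPlusTop F p); rw [hbc, sub_self])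
  rw [h1, logOneAdd_zero] at h
  linear_combination -h

omit [CharZero F] in
/-- The inverse of an element of `1 + Fil¹` lies in `1 + Fil¹`. [cite: FontaineAsterisque223III, Exp. II §1.5.4] -/
theorem inv_sub_one_mem_filOne {b c : BdRPlusTop F p} (hb : b - 1 ∈ (filOne F p).toIdeal) (hbc : b * c = 1) :
    c - 1 ∈ (filOne F p).toIdeal := by
  have e : c - 1 = -(c * (b - 1)) := by linear_combination hbc
  rw [e]
  exact neg_mem (Ideal.mul_mem_left _ _ hb)

/-- **`Γ_F`-equivariance: `σ(log(1 + x)) = log(1 + σ x)`** (tree `gal_evalPt₁`).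
[cite: FontaineAsterisque223III, Exp. II §1.5.4] -/
theorem gal_logOneAdd (σ : absoluteGaloisGroup F) (x : (filOne F p).toIdeal) :
    gal F p σ (logOneAdd x : BdRPlusTop F p) = logOneAdd ⟨gal F p σ x, gal_mem_filOne σ x.2⟩ :=
  gal_evalPt₁ σ logQ constantCoeff_logQ x

/-! ## §3 Truncations: `log(1+x) ≡ L_N(x) (mod Fil^{N+1})`, and `log(1 + ([ε] - 1)) = t` -/

omit [CharZero F] in
/-- Powers of `Fil¹` in the topological copy are the powers of `(ξ_dR) = ker θ` (`Fil^N B_dR⁺ = (ξ_dR)^N`).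
[cite: FontaineAsterisque223III, Exp. II §1.5.3] -/
theorem mem_filOne_pow_iff {x : BdRPlusTop F p} {N : ℕ} :
    x ∈ (filOne F p).toIdeal ^ N ↔ (of F p).symm x ∈ Ideal.span {(xiBdR : BDeRhamPlus (integerC F) p)} ^ N :=
  Iff.rfl

omit [CharZero F] [Fact p.Prime] [Fact (¬ IsUnit (p : integerC F))]
  [IsAdicComplete (Ideal.span {(p : integerC F)}) (integerC F)] in
/-- The truncation `L_N` of the tree (`TruncatedLog.logTrunc N`) and `logQ` have the same coefficients in degrees
`≤ N`. [folklore] -/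
private theorem coeff_logQ_sub_logTrunc_eq_zero (N : ℕ) {n : ℕ} (hn : n ≤ N) :
    PowerSeries.coeff n (logQ - (((logTrunc N).map RatCoeff.of.toRingHom : Polynomial RatCoeff) : PowerSeries RatCoeff)) =
      0 := by
  rw [map_sub, Polynomial.coeff_coe, Polynomial.coeff_map, coeff_logQ, logTrunc, Polynomial.finsetSum_coeff]
  simp only [Polynomial.coeff_C_mul_X_pow]
  rcases n with _ | n
  · rw [if_pos rfl, Finset.sum_eq_zero (fun m _ => if_neg (Nat.succ_ne_zero m).symm), map_zero, sub_zero]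
  · rw [if_neg (Nat.succ_ne_zero n), Finset.sum_eq_single n (fun m _ hm => if_neg (fun h => hm (by omega)))
      (fun h => absurd (Finset.mem_range.2 (by omega)) h), if_pos rfl, RingEquiv.toRingHom_eq_coe,
      RingHom.coe_coe, sub_eq_zero]
    congr 1
    rw [pow_succ, pow_succ, mul_neg_one, mul_neg_one, neg_neg]
    push_cast
    ring

omit [CharZero F] in
/-- Evaluating a `ℚ`-polynomial in the topological copy: `aeval (of y) (q.map (ℚ = RatCoeff)) = of (aeval y q)`.
[folklore] -/
private theorem aeval_of_map_ratCoeff (y : BDeRhamPlus (integerC F) p) (q : Polynomial ℚ) :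
    Polynomial.aeval (of F p y) (q.map RatCoeff.of.toRingHom) = of F p (Polynomial.aeval y q) := by
  induction q using Polynomial.induction_on' with
  | add q r hq hr => simp only [Polynomial.map_add, map_add, hq, hr]
  | monomial n c =>
    rw [Polynomial.map_monomial, Polynomial.aeval_monomial, Polynomial.aeval_monomial, map_mul, map_pow,
      algebraMap_ratCoeff, RingEquiv.toRingHom_eq_coe, RingHom.coe_coe, RingEquiv.symm_apply_apply]

/-- **`log(1+x) ≡ L_N(x) (mod Fil^{N+1})`**: the `ξ`-adic logarithm is congruent to the tree's truncated
logarithm `L_N(x) = Σ_{m<N} (-1)^m x^(m+1)/(m+1)` modulo `(ξ_dR)^(N+1)`. [cite: FontaineAsterisque223III, Exp. II §1.5.4] -/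
theorem logOneAdd_sub_aeval_logTrunc_mem (x : (filOne F p).toIdeal) (N : ℕ) :
    (logOneAdd x : BdRPlusTop F p) - of F p (Polynomial.aeval ((of F p).symm x) (logTrunc N)) ∈
      (filOne F p).toIdeal ^ (N + 1) := by
  set q : Polynomial RatCoeff := (logTrunc N).map RatCoeff.of.toRingHom with hq
  have hx : IsTopologicallyNilpotent (x : BdRPlusTop F p) := (filOne F p).isTopologicallyNilpotent _ x.2
  -- `log(1+x) - L_N(x)` is the value of the series `logQ - L_N`, all of whose coefficients of degree `≤ N` vanish
  have hval : (logOneAdd x : BdRPlusTop F p) - of F p (Polynomial.aeval ((of F p).symm x) (logTrunc N)) =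
      PowerSeries.aeval hx (logQ - (q : PowerSeries RatCoeff)) := by
    rw [map_sub, PowerSeries.aeval_coe, hq, ← aeval_of_map_ratCoeff]
    rfl
  rw [hval]
  have hsum := PowerSeries.hasSum_aeval hx (logQ - (q : PowerSeries RatCoeff))
  have hclosed : IsClosed (((filOne F p).toIdeal ^ (N + 1) : Ideal (BdRPlusTop F p)) : Set (BdRPlusTop F p)) :=
    isClosed_of_pow_le le_rfl
  refine hclosed.mem_of_tendsto hsum (Filter.Eventually.of_forall fun T => ?_)
  refine Ideal.sum_mem _ fun d _ => ?_
  by_cases hd : d ≤ N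
  · rw [hq, coeff_logQ_sub_logTrunc_eq_zero N hd, zero_smul]
    exact Ideal.zero_mem _
  · rw [Algebra.smul_def]
    exact Ideal.mul_mem_left _ _ (Ideal.pow_le_pow_right (by omega) (Ideal.pow_mem_pow x.2 d))

/-- `[ε] - 1 ∈ Fil¹` in the topological copy. [cite: FontaineAsterisque223III, Exp. II §1.5.4] -/
theorem of_uBdR_mem_filOne : of F p (uBdR : BDeRhamPlus (integerC F) p) ∈ (filOne F p).toIdeal :=
  uBdR_mem_span_xiBdR

/-- **`log(1 + ([ε] - 1)) = t`**: Fontaine's `t = log[ε]` of the tree (`BdRPlusLog.tBdR`, the `ξ`-adic limit of the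
`L_N([ε] - 1)`) is the value of `logOneAdd` at `u_dR = [ε] - 1`. [cite: FontaineAsterisque223III, Exp. II §1.5.4]
[cite: FontaineOuyang2022, §5.1.2] -/
theorem logOneAdd_uBdR :
    (logOneAdd ⟨of F p uBdR, of_uBdR_mem_filOne⟩ : BdRPlusTop F p) = of F p tBdR := by
  haveI := isAdicComplete_span_xiBdR (F := F) (p := p)
  have h : (of F p).symm (logOneAdd ⟨of F p uBdR, of_uBdR_mem_filOne⟩ : BdRPlusTop F p) - tBdR = 0 := by
    refine IsHausdorff.haus (IsAdicComplete.toIsHausdorff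
      (I := Ideal.span {(xiBdR : BDeRhamPlus (integerC F) p)})) _ fun N => ?_
    rw [smul_eq_mul, Ideal.mul_top, SModEq.zero]
    have h1 := logOneAdd_sub_aeval_logTrunc_mem (⟨of F p uBdR, of_uBdR_mem_filOne⟩ : (filOne F p).toIdeal) N
    rw [mem_filOne_pow_iff] at h1
    have h2 := logApprox_sub_tBdR_mem (F := F) (p := p) N
    have e : (of F p).symm (logOneAdd ⟨of F p uBdR, of_uBdR_mem_filOne⟩ : BdRPlusTop F p) - tBdR =
        (of F p).symm ((logOneAdd ⟨of F p uBdR, of_uBdR_mem_filOne⟩ : BdRPlusTop F p) -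
          of F p (Polynomial.aeval ((of F p).symm (of F p uBdR)) (logTrunc N))) + (logApprox N - tBdR) := by
      rw [map_sub, RingEquiv.symm_apply_apply, RingEquiv.symm_apply_apply, logApprox_def]; ring
    rw [e]
    exact add_mem (Ideal.pow_le_pow_right (Nat.le_succ N) h1) h2
  rw [sub_eq_zero] at h
  rw [← h, RingEquiv.apply_symm_apply]

/-- **`σ(t) = χ(σ) t` recovered**: equivariance of `logOneAdd` at `[ε] - 1` is the tree's transformation law
(`smul_tBdR`), as a consistency check of the two constructions. [cite: FontaineAsterisque223III, Exp. II §1.5.5] -/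
theorem gal_logOneAdd_uBdR (σ : absoluteGaloisGroup F) :
    gal F p σ (logOneAdd ⟨of F p uBdR, of_uBdR_mem_filOne⟩ : BdRPlusTop F p) =
      of F p (qpToBdR (((GaloisRep.cyclotomicCharacter F p σ : ℤ_[p]ˣ) : ℤ_[p]) : ℚ_[p]) * tBdR) := by
  rw [logOneAdd_uBdR, gal_of, galBdRPlus_tBdR]

/-! ## §4 `log[ε^a] = a · t` for `a ∈ ℤ_p` -/

/-- `[ε^a] - 1 ∈ Fil¹` (`θ[ε^a] = 1`). [cite: FontaineAsterisque223III, Exp. II §1.5.4] -/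
theorem ofAinf_teichmuller_epsPow_sub_one_mem_filOne (a : ℤ_[p]) :
    ofAinf F p (WittVector.teichmuller p (epsPow a : PreTilt (integerC F) p)) - 1 ∈ (filOne F p).toIdeal := by
  rw [← map_one (ofAinf F p), ← map_sub]
  obtain ⟨w, hw⟩ := xi_dvd_teichmuller_epsPow_sub_one (F := F) (p := p) a
  exact ofAinf_mem_filOne (Ideal.mem_span_singleton'.2 ⟨w, by rw [hw, mul_comm]⟩)

/-- The finite-level congruence `L_N([ε^a] - 1) - a·L_N([ε] - 1) ∈ (ξ_dR)^(N+1)` in `B_dR⁺` (image of the tree's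
`AinfLog.aeval_logTruncInt_epsPow_sub_mem`, divided by the unit `N!`). [cite: FontaineAsterisque223III, Exp. II §1.5.4] -/
theorem aeval_logTrunc_epsPow_sub_mem (a : ℤ_[p]) (N : ℕ) :
    Polynomial.aeval (ainfToBdR (WittVector.teichmuller p (epsPow a : PreTilt (integerC F) p)) - 1 :
        BDeRhamPlus (integerC F) p) (logTrunc N) - qpToBdR (a : ℚ_[p]) * logApprox N ∈
      Ideal.span {(xiBdR : BDeRhamPlus (integerC F) p)} ^ (N + 1) := by
  have h := Ideal.mem_map_of_mem (ainfToBdR (F := F) (p := p)) (aeval_logTruncInt_epsPow_sub_mem (F := F) (p := p) a N)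
  rw [Ideal.map_span, Set.image_singleton, map_pow, ainfToBdR_xi, ← Ideal.span_singleton_pow, map_sub, map_mul,
    ainfToBdR_aeval, ainfToBdR_aeval, map_sub, map_one, ainfToBdR_uAinf, ← qpToBdR_coe, aeval_logTruncInt,
    aeval_logTruncInt, ← logApprox_def, mul_left_comm, ← mul_sub,
    Ideal.unit_mul_mem_iff_mem _ (isUnit_natCast_bDeRhamPlus (Nat.factorial_ne_zero N))] at h
  exact h

/-- **`log[ε^a] = a · t` for every `a ∈ ℤ_p`**: `logOneAdd ([ε^a] - 1) = a · t` (exact for `a ∈ ℕ` by `logOneAdd_pow_sub_one`;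
for general `a` by the `p`-adic continuity congruences of the tree, `AinfLog`). [cite: FontaineAsterisque223III, Exp. II §1.5.4–1.5.5]
[cite: FontaineOuyang2022, §5.1.2] -/
theorem logOneAdd_teichmuller_epsPow (a : ℤ_[p]) :
    (logOneAdd ⟨ofAinf F p (WittVector.teichmuller p (epsPow a : PreTilt (integerC F) p)) - 1,
        ofAinf_teichmuller_epsPow_sub_one_mem_filOne a⟩ : BdRPlusTop F p) =
      of F p (qpToBdR (a : ℚ_[p]) * tBdR) := by
  haveI := isAdicComplete_span_xiBdR (F := F) (p := p)
  set x : (filOne F p).toIdeal := ⟨ofAinf F p (WittVector.teichmuller p (epsPow a : PreTilt (integerC F) p)) - 1,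
    ofAinf_teichmuller_epsPow_sub_one_mem_filOne a⟩ with hx
  have hxv : (of F p).symm (x : BdRPlusTop F p) =
      ainfToBdR (WittVector.teichmuller p (epsPow a : PreTilt (integerC F) p)) - 1 := rfl
  have h : (of F p).symm (logOneAdd x : BdRPlusTop F p) - qpToBdR (a : ℚ_[p]) * tBdR = 0 := by
    refine IsHausdorff.haus (IsAdicComplete.toIsHausdorff
      (I := Ideal.span {(xiBdR : BDeRhamPlus (integerC F) p)})) _ fun N => ?_
    rw [smul_eq_mul, Ideal.mul_top, SModEq.zero]
    have h1 := logOneAdd_sub_aeval_logTrunc_mem x N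
    rw [mem_filOne_pow_iff, map_sub, RingEquiv.symm_apply_apply, hxv] at h1
    have h2 := aeval_logTrunc_epsPow_sub_mem (F := F) (p := p) a N
    have h3 := logApprox_sub_tBdR_mem (F := F) (p := p) N
    have e : (of F p).symm (logOneAdd x : BdRPlusTop F p) - qpToBdR (a : ℚ_[p]) * tBdR =
        ((of F p).symm (logOneAdd x : BdRPlusTop F p) -
            Polynomial.aeval (ainfToBdR (WittVector.teichmuller p (epsPow a : PreTilt (integerC F) p)) - 1 :
              BDeRhamPlus (integerC F) p) (logTrunc N)) +
          (Polynomial.aeval (ainfToBdR (WittVector.teichmuller p (epsPow a : PreTilt (integerC F) p)) - 1 :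
              BDeRhamPlus (integerC F) p) (logTrunc N) - qpToBdR (a : ℚ_[p]) * logApprox N) +
          qpToBdR (a : ℚ_[p]) * (logApprox N - tBdR) := by ring
    rw [e]
    exact add_mem (add_mem (Ideal.pow_le_pow_right (Nat.le_succ N) h1) (Ideal.pow_le_pow_right (Nat.le_succ N) h2))
      (Ideal.mul_mem_left _ _ h3)
  rw [sub_eq_zero] at h
  rw [← h, RingEquiv.apply_symm_apply]

end BdRPlusTop


end Literature.NumberTheory.PAdicHodge

end
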